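import Literature.AlgebraicGeometry.Deformation.SmoothLiftGlueDatumQuot
import Literature.AlgebraicGeometry.Morphisms.GlueDataOfOpens
import Literature.AlgebraicGeometry.Morphisms.GlueDataOverBase
import Mathlib.AlgebraicGeometry.Morphisms.Smooth
import HarnessLib

/-!
# Gluing the local lifts, quotient currency, II: the glued scheme `X'` over `Spec A'`, its affine cover by the `Spec Pⱼ`, the gluing relation,
# the overlaps `D(c_{jl})`, and descent of source-local properties ([Hartshorne2010] proof of Thm. 10.2 (a) «we can glue the schemes `U'_i` …
# to obtain a global deformation `X'`»; [StacksProject, Tag 01JA])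

Layer `Literature/AlgebraicGeometry/Deformation`, namespace `Literature.AlgebraicGeometry.Deformation.LiftGluedSchemeQuot`.
PROOF FILE, THEOREMS ONLY (no definition, no instance, no notation, no named fact, no `sorry`).  Sequel head (iv-b) of the (U-glob) organ (cell
`hodgecm-mathlib`, P6 sub-desk P6b, LEAD «M-135»: (iv) GLUE; count-neutral ★ capital).  Imports ★ (iv-a) `SmoothLiftGlueDatumQuot` (the glue-datum
axioms for one pair ∕ one triple), ★ `Morphisms/GlueDataOfOpens` (the open-subscheme gluing constructor `OpensGlueDatum.glueData`, glue relation
`t_ι`, point identification `preimage_range_ι`), ★ `Morphisms/GlueDataOverBase` (morphisms out of a glued scheme: `glueData_existsUnique_desc`,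
`glueData_desc_of_isZariskiLocalAtSource`).

THE PRINT.  [Hartshorne2010, Thm. 10.2 (a), proof, p. 81]: «… we can glue the schemes `U'_i` along these isomorphisms to obtain a global deformation
`X'` of `X`.  …  `X'` is flat over `C'` since each `U'_i` is.»  [StacksProject, Tag 01JA]: the glued scheme `X = ⋃ Xᵢ` with `Xᵢ ∩ Xⱼ = Uᵢⱼ`.

THE INDEXED AFFINE GLUE DATUM (§2; all rings explicit, ONE instance family per layer, the «other charts'» rings over an overlap as FREE families —
no `Algebra S T` instance, restriction maps as ring homs — so the ★ «β» vocabulary `SmoothLiftAtlasVocabularyQuot` instantiates it by `exact`: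
`S j l := chartLift V r j _`, `S' j l := chartLift V r l _` over `V j ⊓ V l`; `T₁ T₂ T₃ j l m :=` the three charts' `chartLift`s over
`V j ⊓ V l ⊓ V m`; maps `restrict`; gluings `gluingOn`; cocycle `disc = 1`): charts `Pⱼ` (`A'`-algebras), pair elements `c_{jl} : Pⱼ` with `c_{jj}`
a unit, over each overlap the two charts' restricted lifts `S_{jl} = Pⱼ[1/c_{jl}]`, `S'_{jl} = P_l[1/c_{lj}]` (ANY `IsLocalization.Away`,
`A'`-towers) with an `A'`-gluing `ψ_{jl} : S_{jl} ≃ₐ[A'] S'_{jl}`, over each ordered triple the three charts' lifts `T₁ = Pⱼ[1/c_{jl}c_{jm}]`,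
`T₂ = P_l[1/c_{lj}c_{lm}]`, `T₃` (a `P_m`-algebra) with restriction ring maps `S_{jl} → T₁ ← S_{jm}`, `S_{lm} → T₂`, and THE COCYCLE HYPOTHESIS
in the criterion form of ★ `SmoothLiftCocycleExactnessQuot` ∕ `SmoothLiftAtlasHingeQuot`: restricted gluings `e₁₂ : T₁ ≃ T₂`, `e₂₃ : T₂ ≃ T₃`,
`e₁₃ : T₁ ≃ T₃` satisfying the three restriction squares (φ-form of ★ (iv-a) `square_of_restricts`) with `e₁₂.trans e₂₃ = e₁₃` (degenerate
triples included: they carry `ψ_{jj} = 1`, §1 `eq_algebraMap_of_criterion_self₃`).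

* §3 **`exists_glued`** — THE GLUED LIFT: a scheme `X'` with `g : X' → Spec A'` and open immersions `ιⱼ : Spec Pⱼ → X'` such that (a) the `ιⱼ`
  cover `X'`; (b) `ιⱼ ≫ g = Spec (A' → Pⱼ)`; (c) GLUING RELATION `Spec (ψ_{jl}⁻¹ ∘ (P_l → S_{lj})) ≫ ι_l = Spec (Pⱼ → S_{jl}) ≫ ιⱼ` on `Spec S_{jl}`;
  (d) `ιⱼ⁻¹(ι_l(Spec P_l)) = D(c_{jl})`; (e) every property of morphisms local at the source holding for the `Spec Pⱼ → Spec A'` holds for `g`.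
* §4 `smooth_of_charts` — (e) at `Smooth` (sequel head (vi), cf. ★ `SmoothLiftableCoverQuot` §5): smooth charts ⇒ `X' → Spec A'` smooth.

NOT HERE: the closed fibre `X' ×_{Spec A'} Spec (A'⧸J) ≅ X₀` ((v-a) ★ `SmoothLiftClosedFibreChartsQuot` + (v-b)); the instantiation at the
canonical atlas of a smooth `X₀ → Spec (A'⧸J)` ((ζ) ATLAS ASSEMBLY).  HC_CM is proved only modulo the printed citations until rung 0 closes;
nothing here bears on a summit statement.

## References
* [Hartshorne2010] R. Hartshorne, *Deformation Theory*, GTM 257, Springer (2010): Thm. 10.2 (a) and its proof (p. 81).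
* [StacksProject] The Stacks Project, Tag 01JA (glueing schemes), Tag 01V4 (smooth morphisms).
* [Hartshorne1977] R. Hartshorne, *Algebraic Geometry*, GTM 52 (1977): II Ex. 2.12 (Glueing Lemma).
* [Oort1971] F. Oort, *Finite group schemes, local moduli for abelian varieties, and lifting problems*, Compositio Math. 23 (1971), §2.2 (pp. 277–279).
-/

noncomputable section

open CategoryTheory AlgebraicGeometry Opposite TopologicalSpace

universe u

namespace Literature.AlgebraicGeometry.Deformation.LiftGluedSchemeQuot

open Literature.AlgebraicGeometry.Morphisms Literature.AlgebraicGeometry.Deformation.LiftGlueDatumQuot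

/-! ## §1 The self-gluing on the degenerate triple, with three (a priori distinct) triple rings -/

section Self

variable {P : Type u} [CommRing P] (c : P) (hc : IsUnit c) {S : Type u} [CommRing S] [Algebra P S] [IsLocalization.Away c S]

include hc in
/-- **`ψ_{jj} = 1` FROM THE CRITERION AT `(j, j, j)`, three-ring form** (cf. ★ (iv-a) `eq_algebraMap_of_criterion_self`): on the degenerate triple the
three triple rings `T₁ T₂ T₃` are all `Pⱼ[1/c_{jj}c_{jj}] ≅ Pⱼ` (`c_{jj}` a unit) but need not be the same type; `S = S_{jj}` maps to `T₁` by two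
restriction maps `l, m` and to `T₂` by `n` (all over `Pⱼ`).  If `e₁₂ : T₁ ≃ T₂`, `e₂₃ : T₂ ≃ T₃`, `e₁₃ : T₁ ≃ T₃` satisfy the three squares over ONE
transition ring map `φ : Pⱼ → S` and `e₁₂.trans e₂₃ = e₁₃`, then `φ` is the structure map (`t j j` = the inclusion). [cite: StacksProject, Tag 01JA]
[cite: Hartshorne2010, Thm. 10.2 (a) (proof), p. 81] -/
theorem eq_algebraMap_of_criterion_self₃ {T₁ : Type u} [CommRing T₁] [Algebra P T₁] {T₂ : Type u} [CommRing T₂] [Algebra P T₂]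
    [IsLocalization.Away (c * c) T₂] {T₃ : Type u} [CommRing T₃] [Algebra P T₃]
    (l : S →+* T₁) (hl : l.comp (algebraMap P S) = algebraMap P T₁) (m : S →+* T₁) (hm : m.comp (algebraMap P S) = algebraMap P T₁)
    (n : S →+* T₂) (hn : n.comp (algebraMap P S) = algebraMap P T₂) (φ : P →+* S) (e₁₂ : T₁ ≃+* T₂) (e₂₃ : T₂ ≃+* T₃) (e₁₃ : T₁ ≃+* T₃)
    (hsq₁₂ : ∀ p, e₁₂ (l (φ p)) = algebraMap P T₂ p) (hsq₂₃ : ∀ p, e₂₃ (n (φ p)) = algebraMap P T₃ p)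
    (hsq₁₃ : ∀ p, e₁₃ (m (φ p)) = algebraMap P T₃ p) (hcoc : e₁₂.trans e₂₃ = e₁₃) : φ = algebraMap P S := by
  -- `l = m` (maps out of the localisation `S` agreeing on `P`)
  have hlm : l = m := IsLocalization.ringHom_ext (Submonoid.powers c) (hl.trans hm.symm)
  -- `P → T₂` and `P → S` are bijective; `n` is injective
  have hbT : Function.Bijective (algebraMap P T₂) := bijective_algebraMap_of_isUnit (c * c) (hc.mul hc) (S := T₂)
  have hbS : Function.Bijective (algebraMap P S) := bijective_algebraMap_of_isUnit c hc (S := S)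
  have hn' : ∀ p, n (algebraMap P S p) = algebraMap P T₂ p := fun p => by rw [← hn, RingHom.comp_apply]
  have hinj : Function.Injective n := by
    intro x y hxy
    obtain ⟨p, rfl⟩ := hbS.2 x; obtain ⟨q, rfl⟩ := hbS.2 y
    rw [hn', hn'] at hxy
    rw [hbT.1 hxy]
  -- `e₁₂ (l (φ p)) = n (φ p)` by the cocycle, and `= p/1 = n (p/1)` by the first square
  ext p
  apply hinj
  rw [hn' p, ← hsq₁₂ p]
  apply e₂₃.injective
  rw [hsq₂₃ p, ← RingEquiv.trans_apply, hcoc, hlm, hsq₁₃]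

end Self

/-! ## §2 The indexed affine glue datum and its hypotheses -/

section Glue

variable {A' : Type u} [CommRing A'] {ι : Type u}
  -- charts: the local lifts
  (P : ι → Type u) [∀ j, CommRing (P j)] [∀ j, Algebra A' (P j)]
  -- pair elements `c j l : P j` (chart `j`'s equation of the overlap with chart `l`)
  (c : ∀ j l : ι, P j)
  -- pair rings over the overlap `(j, l)`: chart `j`'s lift `S j l = P j [1/c j l]` and chart `l`'s lift `S' j l = P l [1/c l j]` (free families)
  (S : ι → ι → Type u) [∀ j l, CommRing (S j l)] [∀ j l, Algebra (P j) (S j l)] [∀ j l, IsLocalization.Away (c j l) (S j l)]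
  [∀ j l, Algebra A' (S j l)] [∀ j l, IsScalarTower A' (P j) (S j l)]
  (S' : ι → ι → Type u) [∀ j l, CommRing (S' j l)] [∀ j l, Algebra (P l) (S' j l)] [∀ j l, IsLocalization.Away (c l j) (S' j l)]
  [∀ j l, Algebra A' (S' j l)] [∀ j l, IsScalarTower A' (P l) (S' j l)]
  -- pair gluings
  (ψ : ∀ j l, S j l ≃ₐ[A'] S' j l)
  -- triple rings over the triple overlap `(j, l, m)`: the three charts' lifts `T₁` (chart `j`), `T₂` (chart `l`), `T₃` (chart `m`)
  (T₁ : ι → ι → ι → Type u) [∀ j l m, CommRing (T₁ j l m)] [∀ j l m, Algebra (P j) (T₁ j l m)]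
  [∀ j l m, IsLocalization.Away (c j l * c j m) (T₁ j l m)]
  (T₂ : ι → ι → ι → Type u) [∀ j l m, CommRing (T₂ j l m)] [∀ j l m, Algebra (P l) (T₂ j l m)]
  [∀ j l m, IsLocalization.Away (c l j * c l m) (T₂ j l m)]
  (T₃ : ι → ι → ι → Type u) [∀ j l m, CommRing (T₃ j l m)] [∀ j l m, Algebra (P m) (T₃ j l m)]
  -- restriction ring maps from the pair rings to the triple rings, over the charts
  (lT : ∀ j l m, S j l →+* T₁ j l m) (hlT : ∀ j l m, (lT j l m).comp (algebraMap (P j) (S j l)) = algebraMap (P j) (T₁ j l m))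
  (mT : ∀ j l m, S j m →+* T₁ j l m) (hmT : ∀ j l m, (mT j l m).comp (algebraMap (P j) (S j m)) = algebraMap (P j) (T₁ j l m))
  (nT : ∀ j l m, S l m →+* T₂ j l m) (hnT : ∀ j l m, (nT j l m).comp (algebraMap (P l) (S l m)) = algebraMap (P l) (T₂ j l m))
  -- the diagonal elements are units (`U j ∩ U j = U j`)
  (hc : ∀ j, IsUnit (c j j))
  -- THE COCYCLE HYPOTHESIS in criterion form (★ `SmoothLiftCocycleExactnessQuot` ∕ `SmoothLiftAtlasHingeQuot`): on every ordered triple the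
  -- restricted gluings `e₁₂ : T₁ ≃ T₂`, `e₂₃ : T₂ ≃ T₃`, `e₁₃ : T₁ ≃ T₃` satisfy the three restriction squares (φ-form, ★ (iv-a) `square_of_restricts`)
  -- over the transition ring maps `φ_{jl} = ψ_{jl}⁻¹ ∘ (P_l → S'_{jl})` and compose
  (hcoc : ∀ j l m, ∃ (e₁₂ : T₁ j l m ≃+* T₂ j l m) (e₂₃ : T₂ j l m ≃+* T₃ j l m) (e₁₃ : T₁ j l m ≃+* T₃ j l m),
    (∀ p, e₁₂ (lT j l m (((ψ j l).symm.toRingEquiv.toRingHom.comp (algebraMap (P l) (S' j l))) p)) = algebraMap (P l) (T₂ j l m) p) ∧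
    (∀ p, e₂₃ (nT j l m (((ψ l m).symm.toRingEquiv.toRingHom.comp (algebraMap (P m) (S' l m))) p)) = algebraMap (P m) (T₃ j l m) p) ∧
    (∀ p, e₁₃ (mT j l m (((ψ j m).symm.toRingEquiv.toRingHom.comp (algebraMap (P m) (S' j m))) p)) = algebraMap (P m) (T₃ j l m) p) ∧
    e₁₂.trans e₂₃ = e₁₃)

/-! ## §3 The glued scheme -/

include hlT hmT hnT hc hcoc in
/-- **THE GLUED LIFT (quotient currency).**  Given the indexed affine glue datum — charts `Pⱼ`, over each overlap `(j,l)` the two charts' restricted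
lifts `S_{jl} = Pⱼ[1/c_{jl}]`, `S'_{jl} = P_l[1/c_{lj}]` with an `A'`-gluing `ψ_{jl} : S_{jl} ≃ S'_{jl}`, over each ordered triple the three charts'
lifts `T₁ T₂ T₃` with restriction maps, `c_{jj}` units, and the criterion-form cocycle on every ordered triple — there is a scheme `X'` over `Spec A'`
with open immersions `ιⱼ : Spec Pⱼ → X'` over `Spec A'` that COVER `X'`, glue along the transitions (`Spec (ψ_{jl}⁻¹ ∘ (P_l → S'_{jl})) ≫ ι_l =
Spec (Pⱼ → S_{jl}) ≫ ιⱼ` on `Spec S_{jl}`), and meet exactly in the principal opens: `ιⱼ⁻¹(ι_l(Spec P_l)) = D(c_{jl})`; and `X' → Spec A'` inherits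
every property local at the source (e.g. `Smooth`, `Flat`, `LocallyOfFiniteType`) from the chart structure maps `Spec Pⱼ → Spec A'`.
(★ `Morphisms/GlueDataOfOpens.OpensGlueDatum` with charts `Spec Pⱼ`, opens the ranges of `Spec (Pⱼ → S_{jl})`, transitions through `Spec ψ_{jl}⁻¹`;
axioms by ★ `SmoothLiftGlueDatumQuot`; structure map by ★ `GlueDataOverBase.glueData_existsUnique_desc`.)
[cite: Hartshorne2010, Thm. 10.2 (a) (proof), p. 81] [cite: StacksProject, Tag 01JA] [cite: Hartshorne1977, II Ex. 2.12] -/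
theorem exists_glued :
    ∃ (X' : Scheme.{u}) (g : X' ⟶ Spec (.of A')) (ιX : ∀ j, Spec (.of (P j)) ⟶ X'),
      (∀ j, IsOpenImmersion (ιX j)) ∧
      (∀ x : X', ∃ j y, ιX j y = x) ∧
      (∀ j, ιX j ≫ g = Spec.map (CommRingCat.ofHom (algebraMap A' (P j)))) ∧
      (∀ j l, Spec.map (CommRingCat.ofHom ((ψ j l).symm.toRingEquiv.toRingHom.comp (algebraMap (P l) (S' j l)))) ≫ ιX l =
        Spec.map (CommRingCat.ofHom (algebraMap (P j) (S j l))) ≫ ιX j) ∧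
      (∀ j l, (ιX j) ⁻¹' Set.range (ιX l) = (PrimeSpectrum.basicOpen (c j l) : Set (PrimeSpectrum (P j)))) ∧
      (∀ Q : MorphismProperty Scheme.{u}, IsZariskiLocalAtSource Q →
        (∀ j, Q (Spec.map (CommRingCat.ofHom (algebraMap A' (P j))))) → Q g) := by
  classical
  -- the overlap immersions (both charts' sides), the transitions
  haveI hoI : ∀ j l, IsOpenImmersion (Spec.map (CommRingCat.ofHom (algebraMap (P j) (S j l)))) :=
    fun j l => IsOpenImmersion.of_isLocalization (c j l)
  let o : ∀ j l, Spec (.of (S j l)) ⟶ Spec (.of (P j)) := fun j l => Spec.map (CommRingCat.ofHom (algebraMap (P j) (S j l)))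
  let o' : ∀ j l, Spec (.of (S' j l)) ⟶ Spec (.of (P l)) := fun j l => Spec.map (CommRingCat.ofHom (algebraMap (P l) (S' j l)))
  let φ : ∀ j l, P l →+* S j l := fun j l => (ψ j l).symm.toRingEquiv.toRingHom.comp (algebraMap (P l) (S' j l))
  let τ : ∀ j l, Spec (.of (S j l)) ⟶ Spec (.of (P l)) := fun j l => Spec.map (CommRingCat.ofHom (φ j l))
  -- the transition factors through the opposite chart's overlap immersion
  have hτ : ∀ j l, τ j l = Spec.map (CommRingCat.ofHom (ψ j l).symm.toRingEquiv.toRingHom) ≫ o' j l := fun j l => by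
    change Spec.map (CommRingCat.ofHom ((ψ j l).symm.toRingEquiv.toRingHom.comp (algebraMap (P l) (S' j l)))) = _
    rw [CommRingCat.ofHom_comp, Spec.map_comp]
  -- ranges of the overlap immersions
  have hmemW : ∀ j l (x : Spec (.of (P j))), x ∈ (o j l).opensRange ↔ x ∈ PrimeSpectrum.basicOpen (c j l) := fun j l x => by
    have e : x ∈ (o j l).opensRange ↔ x ∈ Set.range (o j l) := Iff.rfl
    rw [e, range_specMap_algebraMap (c j l)]
    exact Iff.rfl
  have hmemW' : ∀ j l (y : Spec (.of (S' j l))), o' j l y ∈ (o l j).opensRange := fun j l y => by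
    rw [hmemW]
    have h : o' j l y ∈ Set.range (o' j l) := ⟨y, rfl⟩
    rw [range_specMap_algebraMap (c l j)] at h
    exact h
  -- units from the cocycle hypothesis
  have hunit : ∀ j l m, IsUnit (lT j l m (φ j l (c l m))) := fun j l m => by
    obtain ⟨e₁₂, -, -, h₁₂, -, -, -⟩ := hcoc j l m
    refine isUnit_of_square (lT j l m) (φ j l) e₁₂ h₁₂ (c l m) ?_
    exact isUnit_of_mul_isUnit_right ((map_mul (algebraMap (P l) (T₂ j l m)) (c l j) (c l m)) ▸
      IsLocalization.Away.algebraMap_isUnit (c l j * c l m))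
  -- the self-transitions: `φ j j` is the structure map
  have hφself : ∀ j, φ j j = algebraMap (P j) (S j j) := fun j => by
    obtain ⟨e₁₂, e₂₃, e₁₃, h₁₂, h₂₃, h₁₃, hco⟩ := hcoc j j j
    exact eq_algebraMap_of_criterion_self₃ (c j j) (hc j) (lT j j j) (hlT j j j) (mT j j j) (hmT j j j) (nT j j j) (hnT j j j)
      (φ j j) e₁₂ e₂₃ e₁₃ h₁₂ h₂₃ h₁₃ hco
  -- THE GLUE DATUM
  let 𝒟 : OpensGlueDatum.{u} :=
    { J := ι
      U := fun j => Spec (.of (P j))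
      W := fun j l => (o j l).opensRange
      t := fun j l => (o j l).isoOpensRange.inv ≫ τ j l
      W_self := fun j => by
        haveI := isIso_specMap_algebraMap_of_isUnit (c j j) (hc j) (S := S j j)
        exact Scheme.Hom.opensRange_of_isIso (o j j)
      t_self := fun j => by
        change (o j j).isoOpensRange.inv ≫ Spec.map (CommRingCat.ofHom (φ j j)) = _
        rw [hφself]
        exact (o j j).isoOpensRange_inv_comp
      t_mem := fun j l x => by
        rw [hτ, Scheme.Hom.comp_apply, Scheme.Hom.comp_apply]
        exact hmemW' j l _
      dom := fun j l m x hx => by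
        rw [Scheme.Hom.comp_apply, hmemW]
        refine specMap_apply_mem_basicOpen_of_mem (c j l) (c j m) (lT j l m) (hlT j l m) (φ j l) (c l m) (hunit j l m) _ ?_
        have e : o j l ((o j l).isoOpensRange.inv x) = x.1 := by
          rw [← Scheme.Hom.comp_apply, Scheme.Hom.isoOpensRange_inv_comp, Scheme.Opens.ι_apply]
        rw [e, ← hmemW]
        exact hx
      cocycle := fun i j k O a b c' ha hb hc' => by
        obtain ⟨e₁₂, e₂₃, e₁₃, h₁₂, h₂₃, h₁₃, hco⟩ := hcoc i j k
        have key := specMap_cocycle (c i j) (c i k) (c j k) (lT i j k) (hlT i j k) (mT i j k) (hmT i j k) (nT i j k) (hnT i j k)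
          (φ i j) (φ j k) (φ i k) e₁₂ e₂₃ e₁₃ h₁₂ h₂₃ h₁₃ hco
          (a ≫ (o i j).isoOpensRange.inv) (b ≫ (o j k).isoOpensRange.inv) (c' ≫ (o i k).isoOpensRange.inv) ?_ ?_
        · simpa only [Category.assoc] using key
        · rw [Category.assoc, Scheme.Hom.isoOpensRange_inv_comp, ha, Category.assoc, Scheme.Hom.isoOpensRange_inv_comp, hc']
        · rw [Category.assoc, Scheme.Hom.isoOpensRange_inv_comp, hb, Category.assoc] }
  -- the glued scheme, its charts
  refine ⟨𝒟.glueData.glued, ?_⟩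
  -- the structure map: the chart structure maps agree on the overlaps
  have hp : ∀ i j, 𝒟.glueData.f i j ≫ Spec.map (CommRingCat.ofHom (algebraMap A' (P i))) =
      𝒟.glueData.t i j ≫ 𝒟.glueData.f j i ≫ Spec.map (CommRingCat.ofHom (algebraMap A' (P j))) := fun i j => by
    rw [OpensGlueDatum.glueData_f, OpensGlueDatum.glueData_f, OpensGlueDatum.glueData_t, ← Category.assoc (𝒟.tLift i j),
      OpensGlueDatum.tLift_ι]
    change (o i j).opensRange.ι ≫ _ = ((o i j).isoOpensRange.inv ≫ τ i j) ≫ _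
    rw [← cancel_epi (o i j).isoOpensRange.hom]
    have e1 : (o i j).isoOpensRange.hom ≫ (o i j).opensRange.ι ≫ Spec.map (CommRingCat.ofHom (algebraMap A' (P i))) =
        o i j ≫ Spec.map (CommRingCat.ofHom (algebraMap A' (P i))) := by
      rw [← Category.assoc, Scheme.Hom.isoOpensRange_hom_ι]
    have e2 : (o i j).isoOpensRange.hom ≫ ((o i j).isoOpensRange.inv ≫ τ i j) ≫ Spec.map (CommRingCat.ofHom (algebraMap A' (P j))) =
        τ i j ≫ Spec.map (CommRingCat.ofHom (algebraMap A' (P j))) := by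
      rw [Category.assoc, Iso.hom_inv_id_assoc]
    rw [e1, e2]
    change Spec.map (CommRingCat.ofHom (algebraMap (P i) (S i j))) ≫ Spec.map (CommRingCat.ofHom (algebraMap A' (P i))) =
      Spec.map (CommRingCat.ofHom (φ i j)) ≫ Spec.map (CommRingCat.ofHom (algebraMap A' (P j)))
    rw [← Spec.map_comp, ← Spec.map_comp, ← CommRingCat.ofHom_comp, ← CommRingCat.ofHom_comp]
    congr 2
    ext a
    change algebraMap (P i) (S i j) (algebraMap A' (P i) a) = (ψ i j).symm (algebraMap (P j) (S' i j) (algebraMap A' (P j) a))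
    rw [← IsScalarTower.algebraMap_apply, ← IsScalarTower.algebraMap_apply, AlgEquiv.commutes]
  obtain ⟨g, hg, -⟩ := glueData_existsUnique_desc 𝒟.glueData (fun j => Spec.map (CommRingCat.ofHom (algebraMap A' (P j)))) hp
  refine ⟨g, fun j => 𝒟.glueData.ι j, fun j => inferInstance, ?_, hg, ?_, ?_, fun Q _ hQ =>
    glueData_desc_of_isZariskiLocalAtSource 𝒟.glueData Q _ g hg hQ⟩
  · -- jointly surjective
    intro x
    obtain ⟨j, y, hy⟩ := 𝒟.glueData.ι_jointly_surjective x
    exact ⟨j, y, hy⟩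
  · -- the gluing relation (★ `OpensGlueDatum.t_ι`)
    intro j l
    have h := 𝒟.t_ι j l
    change ((o j l).isoOpensRange.inv ≫ τ j l) ≫ _ = (o j l).opensRange.ι ≫ _ at h
    rw [← cancel_epi (o j l).isoOpensRange.hom, ← Category.assoc, ← Category.assoc, Iso.hom_inv_id, Category.id_comp, ← Category.assoc,
      Scheme.Hom.isoOpensRange_hom_ι] at h
    exact h
  · -- the charts meet in the principal opens (★ `OpensGlueDatum.preimage_range_ι`)
    intro j l
    rw [𝒟.preimage_range_ι l j]
    ext x
    exact hmemW j l x

/-! ## §4 Smoothness of the glued lift from smooth charts (sequel head (vi), cf. ★ `SmoothLiftableCoverQuot` §5) -/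

/-- **The glued lift is smooth over `A'` when the charts are** («`X'` is flat over `A'` since each `U'_i` is»): for a scheme `g : X' → Spec A'`
covered by open immersions `ιⱼ : Spec Pⱼ → X'` over `Spec A'` in the sense of `exists_glued` (any property local at the source descends), if every
`Pⱼ` is a smooth `A'`-algebra then `g` is smooth (Mathlib `HasRingHomProperty @Smooth RingHom.Smooth`). [cite: Hartshorne2010, Thm. 10.2 (a) (proof), p. 81]
[cite: StacksProject, Tag 01V4] -/
theorem smooth_of_charts {X' : Scheme.{u}} (g : X' ⟶ Spec (.of A'))
    (hloc : ∀ Q : MorphismProperty Scheme.{u}, IsZariskiLocalAtSource Q → (∀ j, Q (Spec.map (CommRingCat.ofHom (algebraMap A' (P j))))) → Q g)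
    [∀ j, Algebra.Smooth A' (P j)] : Smooth g :=
  hloc @Smooth inferInstance fun _ => (HasRingHomProperty.Spec_iff (P := @Smooth)).mpr (RingHom.smooth_algebraMap.mpr inferInstance)

end Glue

end Literature.AlgebraicGeometry.Deformation.LiftGluedSchemeQuot


end
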